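import Summits.ABC.IUTFork.Cor312PinnedCountermodel
import Mathlib.GroupTheory.OrderOfElement
import HarnessLib

/-!
# D-0123(C) IUT REPAIR-CATALOGUE (rung LADDER-ABC:A2), NEW row RC-428 (lit-1 sweep row L1-89; KEY wake/KEY-abc-iut-rcat-tst-8-RC-428.md):
# [IUTchIII] Rmk 3.11.4 (i)–(iii) — the Thm 3.11 (iii)(c)(d) «compatibility» READ BY ITS AUTHOR as label-forgetting with
# «invisible» roots-of-unity indeterminacies, typed as claim-tagged readings over `Cor312.Setting`, with KERNEL-CLOSE cells
# (tester abc-iut-rcat-tst-8)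

Record file (D-0012) of the abc-iut cell. TAKES NO SIDE on [IUTchIII] Cor. 3.12 / [IUTchIV] Thm. 1.10 or on any author (D-0045);
nothing here asserts abc proved or refuted. Every `def` below is a `Prop`-valued HYPOTHESIS (a located reading of the author's 2020
text) or an interface-defined SET over the frozen vocabulary (`Cor312.Setting`: `thetaRegion m`, `indGroup`), never a Literature
fact, never asserted; typed ≠ proved; located ≠ adjudicated; refuted-AS-TYPED ≠ refuted-in-print. Standard axioms only.

## THE SOURCE (cell render `HOME/lit/renders/IUTchIII-kurims-url-4b091feeb646/`, kurims ms May 2020, p. 171 l. 13 – p. 173 l. 38)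
(i) p. 171 l. 15–31: «consideration of the log-Kummer correspondence in the context of the compatibility discussed in the final portion
of Theorem 3.11, (iii), (c), (d), amounts precisely to forgetting the labels of the various Frobenius-like “•’s” …, i.e., to
identifying data associated to these Frobenius-like “•’s” with the corresponding data associated to the étale-like “◦”. In
particular, … multiplication of the data considered in Theorem 3.11, (ii), (b), (c), by roots of unity must be “identified” with the
identity automorphism. Put another way, this data … may only be considered up to multiplication by roots of unity. Thus, for
instance, it only makes sense to consider orbits of this data relative to multiplication by roots of unity [i.e., as opposed to
specific elements within such orbits]. This does not cause any problems in the case of the theta values … precisely because the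
theory developed so far was formulated precisely in such a way as to be invariant with respect to such indeterminacies [i.e.,
multiplication of the theta values by 2l-th roots of unity …]»; p. 172 l. 35–42 «the various indeterminacies that, a priori, might
arise … are in fact “invisible”»; (ii) p. 172 l. 43 – p. 173 l. 14 «complete, i.e., there are no further possible indeterminacies»;
(iii) p. 173 l. 15–26 «(Ind1), (Ind2) … have no effect on the geometric containers». [claim: Mochizuki2012, status: disputed]

## THE TYPING (this seat's reading; the referee lanes grade it)
At OUR interface the data of Thm. 3.11 (ii) (b) enter Cor. 3.12 only through the Kummer images `P.thetaRegion m j v_ℚ` (`m ∈ ℤ`, the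
Frobenius-like “•” at `(n, m)`) of the Θ-pilot object in the packets, acted on by the indeterminacy group `indGroup S = ⟨(Ind1) ∪
(Ind2)⟩`. «Multiplication by roots of unity» is a TORSION isometry; its interface shadow is the set `torsionInd S` of elements of
FINITE ORDER of `indGroup S` (§1; no ring structure on the abstract packets is assumed — a typed reading, the referee lanes grade it).
Two claim-tagged HYPOTHESES: **`InvisibleIndet`** («the theory … invariant with respect to such indeterminacies»: every torsion
indeterminacy FIXES every Kummer image of the Θ-pilot) and **`LabelForgetModTorsion`** («forgetting the labels of the Frobenius-like
•’s … up to multiplication by roots of unity»: the Kummer images at any two lattice positions `m, m′` agree up to a torsion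
indeterminacy). Both are Θ-SIDE ONLY: they compare nothing with the q-pilot.

## KERNEL-CLOSE CELLS (this file)
§2 at abc-iut-w4-d101's pinned countermodel (`Cor312Vol.PinnedWitness.pinned_countermodel` p419720) BOTH typed clauses HOLD (every
element of ⟨(Ind1) ∪ (Ind2)⟩ acts by signs and fixes every ball, `NaiveWitness.image_pBall_of_mem_closure`; all Kummer images of the
Θ-pilot are the SAME ball `B_{j²}`, `pinnedSetting_thetaRegion`) together with typed Thm. 3.11 ∧ BridgeHyps ∧ `|log(q)| > 0` ∧
¬Licence ∧ ¬Statement — `invisibleIndet_insufficient`: as SUPPLIERS for Cor. 3.12 the clauses are INSUFFICIENT-as-typed (the shape of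
RC-308's `CandMochizukiSlides3115.thm3115_insufficient` p509263). No judgement on print. [claim: Mochizuki2012, status: disputed]
-/

noncomputable section

open Set

namespace Summit.ABC.IUTFork.Repair.CandMochizukiInvisibleIndet

open Thm311 Cor312 Cor312Vol Literature.IUT.LogThetaLattice

variable {T : ThetaIndex} {S : Situation T} (P : Cor312.Setting S)

/-! ## 1. The row, typed -/

/-- **The torsion indeterminacies** — the interface shadow of «multiplication by roots of unity» (Rmk 3.11.4 (i), p. 171 l. 21–31):
the elements of FINITE ORDER of the indeterminacy group `⟨(Ind1) ∪ (Ind2)⟩` acting on the packets. Interface-defined SET.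
[claim: Mochizuki2012, status: disputed] -/
def torsionInd (S : Situation T) : Set S.L.PacketAut := {Φ | Φ ∈ Setting.indGroup S ∧ IsOfFinOrder Φ}

/-- The identity is a torsion indeterminacy. [folklore] -/
theorem one_mem_torsionInd (S : Situation T) : (1 : S.L.PacketAut) ∈ torsionInd S :=
  ⟨(Setting.indGroup S).one_mem, IsOfFinOrder.one⟩

/-- **`InvisibleIndet`** (Rmk 3.11.4 (i): «the theory developed so far was formulated precisely in such a way as to be invariant with
respect to such indeterminacies [i.e., multiplication of the theta values by 2l-th roots of unity]»; p. 172 «“invisible”, i.e., they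
have no substantive effect on the objects under consideration»), read at our interface: every torsion indeterminacy fixes every Kummer
image of the Θ-pilot object in every packet. Claim-tagged HYPOTHESIS; never asserted. [claim: Mochizuki2012, status: disputed] -/
@[claim "Mochizuki2012" "disputed"]
def InvisibleIndet : Prop :=
  ∀ Φ ∈ torsionInd S, ∀ (m : ℤ) (j : T.Label) (vQ : T.VQ), Φ j vQ '' P.thetaRegion m j vQ = P.thetaRegion m j vQ

/-- **`LabelForgetModTorsion`** (Rmk 3.11.4 (i): the compatibility «amounts precisely to forgetting the labels of the various
Frobenius-like “•’s” … this data … may only be considered up to multiplication by roots of unity»), read at our interface: the Kummer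
images of the Θ-pilot object at any two lattice positions `m, m′` (two Frobenius-like “•’s”) coincide up to a torsion indeterminacy.
Claim-tagged HYPOTHESIS; never asserted. [claim: Mochizuki2012, status: disputed] -/
@[claim "Mochizuki2012" "disputed"]
def LabelForgetModTorsion : Prop :=
  ∀ (m m' : ℤ) (j : T.Label) (vQ : T.VQ), ∃ Φ ∈ torsionInd S, Φ j vQ '' P.thetaRegion m j vQ = P.thetaRegion m' j vQ

variable {P}

/-- If all Kummer images of the Θ-pilot coincide (no (Ind3)-variation in `m`), the labels are forgotten by the identity. [folklore] -/
theorem labelForgetModTorsion_of_const (h : ∀ (m m' : ℤ) (j : T.Label) (vQ : T.VQ), P.thetaRegion m j vQ = P.thetaRegion m' j vQ) :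
    LabelForgetModTorsion P := fun m m' j vQ =>
  ⟨1, one_mem_torsionInd S, by
    have h1 : ((1 : S.L.PacketAut) j vQ : S.L.Packet j vQ → S.L.Packet j vQ) = id := rfl
    rw [h1, Set.image_id]
    exact h m m' j vQ⟩

/-- If EVERY indeterminacy fixes every Kummer image of the Θ-pilot, the torsion ones do. [folklore] -/
theorem invisibleIndet_of_fixed
    (h : ∀ Φ ∈ Setting.indGroup S, ∀ (m : ℤ) (j : T.Label) (vQ : T.VQ), Φ j vQ '' P.thetaRegion m j vQ = P.thetaRegion m j vQ) :
    InvisibleIndet P := fun Φ hΦ m j vQ => h Φ hΦ.1 m j vQ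

/-! ## 2. At the pinned countermodel of record both clauses HOLD with ¬Statement: INSUFFICIENT as typed -/

section Pinned

open Cor312.Checks Cor312.IdentifiedNonVacuity Cor312Vol.NaiveWitness Cor312Vol.PinnedWitness Thm311ToCor312

variable (p : ℕ)

/-- At the pinned countermodel every indeterminacy fixes every Kummer image `B_{j²}` of the Θ-pilot. [folklore] -/
theorem thetaRegion_fixed_pinnedSetting {Φ : signShells.PacketAut}
    (hΦ : Φ ∈ Subgroup.closure (signShells.Ind1Family ∪ signShells.Ind2Family)) (m : ℤ) (j : toyIndex.Label) (vQ : toyIndex.VQ) :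
    Φ j vQ '' (pinnedSetting p).thetaRegion m j vQ = (pinnedSetting p).thetaRegion m j vQ := by
  rw [pinnedSetting_thetaRegion, image_pBall_of_mem_closure p hΦ]

/-- **`InvisibleIndet` HOLDS at the pinned countermodel.** [folklore] -/
theorem invisibleIndet_pinnedSetting : InvisibleIndet (pinnedSetting p) :=
  invisibleIndet_of_fixed fun _ hΦ m j vQ => thetaRegion_fixed_pinnedSetting p hΦ m j vQ

/-- **`LabelForgetModTorsion` HOLDS at the pinned countermodel** (all Kummer images are `B_{j²}`). [folklore] -/
theorem labelForgetModTorsion_pinnedSetting : LabelForgetModTorsion (pinnedSetting p) :=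
  labelForgetModTorsion_of_const fun m m' j vQ => by rw [pinnedSetting_thetaRegion, pinnedSetting_thetaRegion]

/-- The countermodel's indeterminacy group has torsion elements (the identity; every element acts by signs, hence has order ≤ 2) —
recorded so the clauses are visibly not about an empty set. [folklore] -/
theorem one_mem_torsionInd_pinned : (1 : signShells.PacketAut) ∈ torsionInd (naiveFull p).toLatticeSituation.toSituation :=
  one_mem_torsionInd _

variable [hp : Fact p.Prime]

/-- **KERNEL-CLOSE, PACKAGED (`p = 2`) — INSUFFICIENT as typed**: at the countermodel of record, typed Thm. 3.11 ∧ BridgeHyps ∧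
`|log(q)| > 0` ∧ `InvisibleIndet` ∧ `LabelForgetModTorsion` hold TOGETHER WITH ¬Licence ∧ ¬Statement: the Rmk 3.11.4 reading of the
(iii)(c)(d) compatibility, typed Θ-side, supplies no comparison with the q-pilot. No judgement on print. [folklore] -/
theorem invisibleIndet_insufficient :
    ∃ (T : ThetaIndex) (F : FullSituation T) (P : Cor312.Setting F.toLatticeSituation.toSituation),
      F.Statement ∧ BridgeHyps P ∧ P.AbsLogQPos ∧ InvisibleIndet P ∧ LabelForgetModTorsion P ∧
        ¬ Licence P ∧ ¬ P.Statement := by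
  haveI : Fact (Nat.Prime 2) := ⟨Nat.prime_two⟩
  exact ⟨toyIndex, naiveFull 2, pinnedSetting 2, naiveFull_statement 2, pinnedSetting_bridgeHyps 2, pinnedSetting_absLogQPos 2,
    invisibleIndet_pinnedSetting 2, labelForgetModTorsion_pinnedSetting 2, pinnedSetting_not_licence 2, pinnedSetting_not_statement 2⟩

end Pinned

end Summit.ABC.IUTFork.Repair.CandMochizukiInvisibleIndet

end
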